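import Mathlib
import HarnessLib
import Summits.Ventures.LatticeQCDFlow.Exactness.WilsonJitterZeroConsistency
import Summits.Ventures.LatticeQCDFlow.Exactness.UniformJitterLawAtomless

/-!
# The `tau_jitter` law in closed form: `uniformJitterLaw τ j = |2τj|⁻¹ · Leb|_{[τ(1−j), τ(1+j)]}` — density, Radon–Nikodym derivative, and the jittered engine kernel as the WINDOW AVERAGE of the fixed-length kernels

HONEST FRAMING: exact (Metropolis-corrected) sampling algorithms for lattice gauge theory;
figures of merit are autocorrelation/cost numbers at stated couplings and volumes; no
continuum-physics claim.

Venture `LatticeQCDFlow` (cell pub-lqcd), topic `Exactness`, FANOUT row 9 (eng-latcore, GEN-25; item (R4) of the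
GEN-24 HANDOFF).  The engine (`latflow.core.hmc.HMC.trajectory`, 0.2.1+): `tau_t = tau * (1 + tau_jitter * (2u − 1))`,
`u ∼ U(0,1)` drawn before and independently of the state.  GEN-24 typed the law as a PUSH-FORWARD
(`UniformJitterLaw.lean`: `uniformJitterLaw τ j := (volume|_{[0,1]}).map (u ↦ τ(1 + j(2u − 1)))`) and read every
certificate through the window mass `η[τ₁, τ₂]`; `UniformJitterLawAtomless.lean` bounded it by `|2τj|⁻¹ · Leb`.  This
file gives the EQUALITY.  NEW WORK of the cell (Mathlib only for §1–§2: `Real.volume_preimage_mul_left`,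
`measure_preimage_add`, `segment_eq_image_lineMap`, `segment_eq_uIcc`, `withDensity_indicator`, `withDensity_const`,
`Measure.rnDeriv_withDensity`, with GEN-24's `jitterFormula_eq_affine` / `jitterFormula_injective` of
`UniformJitterLawAtomless.lean`; §3 over GEN-24's `wilsonJitterHMCL_apply` / `wilsonLeapfrogHMC` / `wilsonJitterHMCL_dirac`).
Nothing is cited as a fact; no number is claimed.

## Content

* §1 `jitterFormula_eq_lineMap`, `image_jitterFormula_Icc` (the drawn lengths fill exactly the window
  `uIcc (τ(1−j)) (τ(1+j))`), `volume_preimage_jitterFormula` (`τj ≠ 0`: `Leb (f⁻¹ t) = |2τj|⁻¹ · Leb t`);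
  **`uniformJitterLaw_eq_smul_restrict`** — for `τj ≠ 0`,
  `uniformJitterLaw τ j = (ENNReal.ofReal |2τj|)⁻¹ • volume.restrict (uIcc (τ(1−j)) (τ(1+j)))`;
  **`uniformJitterLaw_apply_eq`** (every set `s`: `η s = |2τj|⁻¹ · Leb (s ∩ window)`);
  **`uniformJitterLaw_eq_smul_restrict_Icc`** (`τ, j > 0`: the window is `[τ(1−j), τ(1+j)]`, the constant `(2τj)⁻¹`).
* §2 **`uniformJitterLaw_eq_withDensity`** — `η = Leb.withDensity (𝟙_window · |2τj|⁻¹)`: the law HAS A DENSITY, the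
  normalised indicator of the window; **`rnDeriv_uniformJitterLaw`** — `dη/dLeb = 𝟙_window · |2τj|⁻¹` a.e.;
  **`lintegral_uniformJitterLaw`** — `∫ g dη = |2τj|⁻¹ ∫_window g dLeb` for every measurable `g ≥ 0`.
* §3 **`wilsonJitterHMCL_apply_eq_lintegral_wilsonLeapfrogHMC`** — for EVERY law `η` of the length the jittered engine
  kernel is the `η`-mixture of the DEFAULT fixed-length engine kernels `wilsonLeapfrogHMC N d L β nstep τ'`;
  **`wilson_uniformJitterHMC_apply`** — THE ENGINE AS RUN (`τ, j > 0`): for every configuration `U` and event `A`,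
  `K_jit(U, A) = (2τj)⁻¹ ∫_{τ(1−j)}^{τ(1+j)} K_{τ'}(U, A) dτ'` — the transition probability under `tau_jitter = j` is
  the plain AVERAGE over the window of the fixed-length transition probabilities (so every convex bound that holds
  for each length in the window holds for the jittered kernel).

NOT CLAIMED: anything about the 53-bit floating-point uniform of the code (GEN-22's atom reading); `τj = 0` in §1–§2
(then the law is the point mass `δ_τ` resp. `δ_0`-type degenerate image and has no density — `uniformJitterLaw_zero_right`);
that averaging over lengths improves any autocorrelation.
-/

noncomputable section

namespace Summit.Ventures.LatticeQCDFlow.Exactness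

open MeasureTheory Set
open scoped ENNReal

/-! ## §1 The law is the normalised Lebesgue measure of the window -/

section ClosedForm

/-- The code's formula is `lineMap (τ(1−j)) (τ(1+j))`. -/
theorem jitterFormula_eq_lineMap (τ j : ℝ) :
    (fun u : ℝ => τ * (1 + j * (2 * u - 1))) = ⇑(AffineMap.lineMap (k := ℝ) (τ * (1 - j)) (τ * (1 + j))) := by
  funext u
  rw [AffineMap.lineMap_apply_ring']
  ring

/-- **THE DRAWN LENGTHS FILL EXACTLY THE WINDOW**: the image of `[0, 1]` under the code's formula is
`uIcc (τ(1−j)) (τ(1+j))` (every real `τ`, `j`). -/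
theorem image_jitterFormula_Icc (τ j : ℝ) :
    (fun u : ℝ => τ * (1 + j * (2 * u - 1))) '' Icc 0 1 = uIcc (τ * (1 - j)) (τ * (1 + j)) := by
  rw [jitterFormula_eq_lineMap, ← segment_eq_image_lineMap, segment_eq_uIcc]

/-- **LEBESGUE MEASURE OF A PREIMAGE UNDER THE CODE'S FORMULA** (`τj ≠ 0`): `Leb (f⁻¹ t) = |2τj|⁻¹ · Leb t`. -/
theorem volume_preimage_jitterFormula {τ j : ℝ} (h : τ * j ≠ 0) (t : Set ℝ) :
    volume ((fun u : ℝ => τ * (1 + j * (2 * u - 1))) ⁻¹' t) = (ENNReal.ofReal |2 * τ * j|)⁻¹ * volume t := by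
  have h2 : 2 * τ * j ≠ 0 := by
    rw [mul_assoc]; exact mul_ne_zero two_ne_zero h
  have hcomp : (fun u : ℝ => τ * (1 + j * (2 * u - 1))) =
      (fun x : ℝ => τ * (1 - j) + x) ∘ fun u : ℝ => 2 * τ * j * u := by
    funext u; simp only [Function.comp, jitterFormula_eq_affine]
  rw [hcomp, preimage_comp, Real.volume_preimage_mul_left h2, measure_preimage_add, abs_inv,
    ENNReal.ofReal_inv_of_pos (abs_pos.2 h2)]

/-- **THE `tau_jitter` LAW IN CLOSED FORM** (`τj ≠ 0`): `uniformJitterLaw τ j = |2τj|⁻¹ • Leb|_{uIcc (τ(1−j)) (τ(1+j))}`. -/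
theorem uniformJitterLaw_eq_smul_restrict {τ j : ℝ} (h : τ * j ≠ 0) :
    uniformJitterLaw τ j =
      (ENNReal.ofReal |2 * τ * j|)⁻¹ • (volume : Measure ℝ).restrict (uIcc (τ * (1 - j)) (τ * (1 + j))) := by
  refine Measure.ext fun s hs => ?_
  set f : ℝ → ℝ := fun u => τ * (1 + j * (2 * u - 1)) with hf
  have hfm : Measurable f := measurable_jitterFormula τ j
  have hpre : f ⁻¹' s ∩ Icc 0 1 = f ⁻¹' (s ∩ uIcc (τ * (1 - j)) (τ * (1 + j))) := by
    rw [preimage_inter, ← image_jitterFormula_Icc, (jitterFormula_injective h).preimage_image]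
  rw [uniformJitterLaw, Measure.map_apply hfm hs, Measure.restrict_apply (hfm hs), hpre,
    volume_preimage_jitterFormula h, Measure.smul_apply, smul_eq_mul, Measure.restrict_apply hs]

/-- **THE MASS OF EVERY SET** (`τj ≠ 0`, any `s`, measurable or not): `η s = |2τj|⁻¹ · Leb (s ∩ window)`. -/
theorem uniformJitterLaw_apply_eq {τ j : ℝ} (h : τ * j ≠ 0) (s : Set ℝ) :
    uniformJitterLaw τ j s = (ENNReal.ofReal |2 * τ * j|)⁻¹ * volume (s ∩ uIcc (τ * (1 - j)) (τ * (1 + j))) := by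
  rw [uniformJitterLaw_eq_smul_restrict h, Measure.smul_apply, smul_eq_mul, Measure.restrict_apply' measurableSet_uIcc]

/-- **POSITIVE PARAMETERS** (`τ > 0`, `j > 0` — the engine's case): the window is `[τ(1−j), τ(1+j)]` and the constant is
`(2τj)⁻¹`. -/
theorem uniformJitterLaw_eq_smul_restrict_Icc {τ j : ℝ} (hτ : 0 < τ) (hj : 0 < j) :
    uniformJitterLaw τ j =
      (ENNReal.ofReal (2 * τ * j))⁻¹ • (volume : Measure ℝ).restrict (Icc (τ * (1 - j)) (τ * (1 + j))) := by
  have h : τ * j ≠ 0 := (mul_pos hτ hj).ne'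
  have hle : τ * (1 - j) ≤ τ * (1 + j) := mul_le_mul_of_nonneg_left (by linarith) hτ.le
  rw [uniformJitterLaw_eq_smul_restrict h, uIcc_of_le hle, abs_of_pos (by positivity)]

/-- Positive parameters, every set: `η s = (2τj)⁻¹ · Leb (s ∩ [τ(1−j), τ(1+j)])`. -/
theorem uniformJitterLaw_apply_eq_Icc {τ j : ℝ} (hτ : 0 < τ) (hj : 0 < j) (s : Set ℝ) :
    uniformJitterLaw τ j s = (ENNReal.ofReal (2 * τ * j))⁻¹ * volume (s ∩ Icc (τ * (1 - j)) (τ * (1 + j))) := by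
  rw [uniformJitterLaw_eq_smul_restrict_Icc hτ hj, Measure.smul_apply, smul_eq_mul,
    Measure.restrict_apply' measurableSet_Icc]

end ClosedForm

/-! ## §2 Density and Radon–Nikodym derivative -/

section Density

/-- **THE LAW HAS A DENSITY**: `η = Leb.withDensity (𝟙_{window} · |2τj|⁻¹)` (`τj ≠ 0`). -/
theorem uniformJitterLaw_eq_withDensity {τ j : ℝ} (h : τ * j ≠ 0) :
    uniformJitterLaw τ j = (volume : Measure ℝ).withDensity
      ((uIcc (τ * (1 - j)) (τ * (1 + j))).indicator fun _ => (ENNReal.ofReal |2 * τ * j|)⁻¹) := by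
  rw [withDensity_indicator measurableSet_uIcc, withDensity_const, uniformJitterLaw_eq_smul_restrict h]

/-- **THE RADON–NIKODYM DERIVATIVE**: `dη/dLeb = 𝟙_{window} · |2τj|⁻¹` Lebesgue-a.e. (`τj ≠ 0`). -/
theorem rnDeriv_uniformJitterLaw {τ j : ℝ} (h : τ * j ≠ 0) :
    (uniformJitterLaw τ j).rnDeriv volume =ᵐ[volume]
      (uIcc (τ * (1 - j)) (τ * (1 + j))).indicator fun _ => (ENNReal.ofReal |2 * τ * j|)⁻¹ := by
  rw [uniformJitterLaw_eq_withDensity h]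
  exact Measure.rnDeriv_withDensity _ (measurable_const.indicator measurableSet_uIcc)

/-- **INTEGRATION AGAINST THE LAW IS THE NORMALISED WINDOW INTEGRAL** (`τj ≠ 0`, every `g ≥ 0`). -/
theorem lintegral_uniformJitterLaw {τ j : ℝ} (h : τ * j ≠ 0) (g : ℝ → ℝ≥0∞) :
    ∫⁻ x, g x ∂(uniformJitterLaw τ j) =
      (ENNReal.ofReal |2 * τ * j|)⁻¹ * ∫⁻ x in uIcc (τ * (1 - j)) (τ * (1 + j)), g x := by
  rw [uniformJitterLaw_eq_smul_restrict h, lintegral_smul_measure, smul_eq_mul]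

/-- Positive parameters: `∫ g dη = (2τj)⁻¹ ∫_{[τ(1−j), τ(1+j)]} g dLeb`. -/
theorem lintegral_uniformJitterLaw_Icc {τ j : ℝ} (hτ : 0 < τ) (hj : 0 < j) (g : ℝ → ℝ≥0∞) :
    ∫⁻ x, g x ∂(uniformJitterLaw τ j) =
      (ENNReal.ofReal (2 * τ * j))⁻¹ * ∫⁻ x in Icc (τ * (1 - j)) (τ * (1 + j)), g x := by
  rw [uniformJitterLaw_eq_smul_restrict_Icc hτ hj, lintegral_smul_measure, smul_eq_mul]

end Density

/-! ## §3 The jittered engine kernel is the window average of the fixed-length engine kernels -/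

section Engine

open ProbabilityTheory ProbabilityTheory.Kernel
open Literature.MathematicalPhysics.QuantumFieldTheory

set_option backward.isDefEq.respectTransparency false

variable {N d L : ℕ} [NeZero L]

/-- **FOR EVERY LAW OF THE LENGTH, THE JITTERED ENGINE KERNEL IS THE MIXTURE OF THE DEFAULT FIXED-LENGTH ENGINE
KERNELS**: `K_η(U, A) = ∫ K_{τ'}(U, A) dη(τ')` with `K_{τ'} = wilsonLeapfrogHMC N d L β nstep τ'`. -/
theorem wilsonJitterHMCL_apply_eq_lintegral_wilsonLeapfrogHMC (β : ℝ) (nstep : ℕ) (η : Measure ℝ) [SFinite η]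
    (U : GaugeConfig d L (Matrix.specialUnitaryGroup (Fin N) ℂ))
    {A : Set (GaugeConfig d L (Matrix.specialUnitaryGroup (Fin N) ℂ))} (hA : MeasurableSet A) :
    wilsonJitterHMCL N d L β nstep η U A = ∫⁻ τ', wilsonLeapfrogHMC N d L β nstep τ' U A ∂η := by
  rw [wilsonJitterHMCL_apply (N := N) (d := d) (L := L) β nstep η U hA]
  rfl

/-- **THE ENGINE AS RUN: THE TRANSITION PROBABILITY UNDER `tau_jitter = j` IS THE WINDOW AVERAGE OF THE FIXED-LENGTH
TRANSITION PROBABILITIES** (`τ > 0`, `j > 0`): for every configuration `U` and every event `A`,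
`K_jit(U, A) = (2τj)⁻¹ ∫_{[τ(1−j), τ(1+j)]} K_{τ'}(U, A) dτ'`. -/
theorem wilson_uniformJitterHMC_apply (β : ℝ) (nstep : ℕ) {τ j : ℝ} (hτ : 0 < τ) (hj : 0 < j)
    (U : GaugeConfig d L (Matrix.specialUnitaryGroup (Fin N) ℂ))
    {A : Set (GaugeConfig d L (Matrix.specialUnitaryGroup (Fin N) ℂ))} (hA : MeasurableSet A) :
    wilsonJitterHMCL N d L β nstep (uniformJitterLaw τ j) U A =
      (ENNReal.ofReal (2 * τ * j))⁻¹ *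
        ∫⁻ τ' in Icc (τ * (1 - j)) (τ * (1 + j)), wilsonLeapfrogHMC N d L β nstep τ' U A := by
  rw [wilsonJitterHMCL_apply_eq_lintegral_wilsonLeapfrogHMC β nstep _ U hA,
    uniformJitterLaw_eq_smul_restrict_Icc hτ hj, lintegral_smul_measure, smul_eq_mul]

/-- **GENERAL SIGNS** (`τj ≠ 0`): the same with the window `uIcc (τ(1−j)) (τ(1+j))` and the constant `|2τj|⁻¹`. -/
theorem wilsonJitterHMCL_uniformJitterLaw_apply (β : ℝ) (nstep : ℕ) {τ j : ℝ} (h : τ * j ≠ 0)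
    (U : GaugeConfig d L (Matrix.specialUnitaryGroup (Fin N) ℂ))
    {A : Set (GaugeConfig d L (Matrix.specialUnitaryGroup (Fin N) ℂ))} (hA : MeasurableSet A) :
    wilsonJitterHMCL N d L β nstep (uniformJitterLaw τ j) U A =
      (ENNReal.ofReal |2 * τ * j|)⁻¹ *
        ∫⁻ τ' in uIcc (τ * (1 - j)) (τ * (1 + j)), wilsonLeapfrogHMC N d L β nstep τ' U A := by
  rw [wilsonJitterHMCL_apply_eq_lintegral_wilsonLeapfrogHMC β nstep _ U hA,
    uniformJitterLaw_eq_smul_restrict h, lintegral_smul_measure, smul_eq_mul]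

/-- **CONSEQUENCE: A BOUND VALID FOR EVERY LENGTH IN THE WINDOW IS VALID FOR THE JITTERED KERNEL** (`τ, j > 0`): if
`K_{τ'}(U, A) ≤ b` for every `τ' ∈ [τ(1−j), τ(1+j)]` then `K_jit(U, A) ≤ b` (the average of numbers `≤ b` is `≤ b`). -/
theorem wilson_uniformJitterHMC_apply_le_of_forall_window (β : ℝ) (nstep : ℕ) {τ j : ℝ} (hτ : 0 < τ) (hj : 0 < j)
    (U : GaugeConfig d L (Matrix.specialUnitaryGroup (Fin N) ℂ))
    {A : Set (GaugeConfig d L (Matrix.specialUnitaryGroup (Fin N) ℂ))} (hA : MeasurableSet A) {b : ℝ≥0∞}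
    (hb : ∀ τ' ∈ Icc (τ * (1 - j)) (τ * (1 + j)), wilsonLeapfrogHMC N d L β nstep τ' U A ≤ b) :
    wilsonJitterHMCL N d L β nstep (uniformJitterLaw τ j) U A ≤ b := by
  have hc : 0 < 2 * τ * j := by positivity
  rw [wilson_uniformJitterHMC_apply β nstep hτ hj U hA]
  calc (ENNReal.ofReal (2 * τ * j))⁻¹ * ∫⁻ τ' in Icc (τ * (1 - j)) (τ * (1 + j)), wilsonLeapfrogHMC N d L β nstep τ' U A
      ≤ (ENNReal.ofReal (2 * τ * j))⁻¹ * ∫⁻ _ in Icc (τ * (1 - j)) (τ * (1 + j)), b :=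
        mul_le_mul' le_rfl (setLIntegral_mono measurable_const fun τ' hτ' => hb τ' hτ')
    _ = b := by
        rw [MeasureTheory.setLIntegral_const, Real.volume_Icc, show τ * (1 + j) - τ * (1 - j) = 2 * τ * j by ring,
          mul_comm b, ← mul_assoc, ENNReal.inv_mul_cancel (ENNReal.ofReal_pos.2 hc).ne' ENNReal.ofReal_ne_top, one_mul]

/-- … and likewise from below: `b ≤ K_{τ'}(U, A)` on the window gives `b ≤ K_jit(U, A)`. -/
theorem wilson_uniformJitterHMC_le_apply_of_forall_window (β : ℝ) (nstep : ℕ) {τ j : ℝ} (hτ : 0 < τ) (hj : 0 < j)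
    (U : GaugeConfig d L (Matrix.specialUnitaryGroup (Fin N) ℂ))
    {A : Set (GaugeConfig d L (Matrix.specialUnitaryGroup (Fin N) ℂ))} (hA : MeasurableSet A) {b : ℝ≥0∞}
    (hb : ∀ τ' ∈ Icc (τ * (1 - j)) (τ * (1 + j)), b ≤ wilsonLeapfrogHMC N d L β nstep τ' U A) :
    b ≤ wilsonJitterHMCL N d L β nstep (uniformJitterLaw τ j) U A := by
  have hc : 0 < 2 * τ * j := by positivity
  rw [wilson_uniformJitterHMC_apply β nstep hτ hj U hA]
  calc b = (ENNReal.ofReal (2 * τ * j))⁻¹ * ∫⁻ _ in Icc (τ * (1 - j)) (τ * (1 + j)), b := by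
        rw [MeasureTheory.setLIntegral_const, Real.volume_Icc, show τ * (1 + j) - τ * (1 - j) = 2 * τ * j by ring,
          mul_comm b, ← mul_assoc, ENNReal.inv_mul_cancel (ENNReal.ofReal_pos.2 hc).ne' ENNReal.ofReal_ne_top, one_mul]
    _ ≤ (ENNReal.ofReal (2 * τ * j))⁻¹ * ∫⁻ τ' in Icc (τ * (1 - j)) (τ * (1 + j)), wilsonLeapfrogHMC N d L β nstep τ' U A :=
        mul_le_mul' le_rfl (setLIntegral_mono' measurableSet_Icc fun τ' hτ' => hb τ' hτ')

end Engine

end Summit.Ventures.LatticeQCDFlow.Exactness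

end
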